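import Summits.BirchSwinnertonDyer.BirchSwinnertonDyer.Theorems.ThetaPartnerAtTwoSignedControlAtTwoCasselsLift
import Summits.BirchSwinnertonDyer.Rank1Residual.X11b.AnticyclotomicLevelStructure
import Summits.BirchSwinnertonDyer.BirchSwinnertonDyer.Theorems.ThetaPartnerAtTwoSignedControlAtTwoCasselsBockstein
import Literature.NumberTheory.EllipticCurves.LocalKummerMap
import Literature.NumberTheory.EllipticCurves.LocalPointsIntegersSubgroup
import Literature.NumberTheory.EllipticCurves.StrictSelmerRankOne
import Literature.NumberTheory.EllipticCurves.SelmerTorsionInclusion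
import Literature.NumberTheory.EllipticCurves.SelmerLevelToPrimary
import Literature.NumberTheory.EllipticCurves.BSDQuadraticDescentShaOddPartProofs
import HarnessLib

set_option linter.dupNamespace false -- `…BirchSwinnertonDyer.BirchSwinnertonDyer…` is the cell's nested layout (D-0017)
set_option autoImplicit false

/-!
# Cassels' theorem with rational `p`-torsion: at a finite place `𝔮 ∤ p` and deep level, the local image of the Selmer
# group is the local image of the Kummer classes of `E(K)` — `loc_𝔮 Sel_N(E/K) = loc_𝔮 κ_N(E(K))`, `Sel_{p^∞}(E/K)` finite
# (Greenberg LNM 1716 §4 Appendix Prop. 4.13: the «`E(F)_p`» side of the cokernel)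

Seat `bsd-inputs-k4-p1` (gen 7; LADDER-BSD D-0154 KEY (147)(f) «prove the printed input», row 1 K4 INPUTS; Greenberg
1999), `--supports stmt-BirchSwinnertonDyer-20309`. THEOREMS ONLY (no definition, no named fact, no `sorry`).

R. Greenberg, LNM 1716 (1999), §4 p. 104 / Prop. 4.13 (pp. 121–122): `𝒫_E^Σ(F)/𝒢_E^Σ(F) ≅ E(F)_p^∧` (Cassels). By the
exact relaxation index (`relIndex_selmerGroup_kummerOutside_mul_natCard_map_eq_odd`, previous file) the cokernel of
`H¹_{𝓛, ⊤ at 𝔮}(K, E[N]) → H¹(K_𝔮, E)[N]` has order `#loc_𝔮 Sel_N(E/K)`; this file identifies `loc_𝔮 Sel_N(E/K)` at a place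
`𝔮 ∤ p` and a deep level `N = p^e · p^{k₀}`:

* §1 `exists_pow_divisible_point_adicCompletion` — LOCAL ALGEBRA at `𝔮 ∤ p`: there is `a` with `p^{a+j} E(K_𝔮) ∋ p^a X` for
  all `X ∈ E(K_𝔮)`, `j ≥ 0`, and `p^a` kills `E(K_𝔮)[p^∞]` (Silverman VII.6.3: a torsion-free finite-index `U ≅ 𝓞_𝔮` with
  `[U : nU] = #(𝓞_𝔮/n) = 1` for `n = p^j`, tree `exists_finiteIndex_torsionFree_adicCompletion`; Bézout).
* §2 `localization_kummerMapTorsion_eq_localKummerMap` (`loc_𝔮 κ_N(P) = κ_{N,𝔮}(P)`), `map_torsionMulBy_localKummerMap`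
  (`[m]_* κ_{md,𝔮}(X) = κ_{d,𝔮}(X)`).
* §3 **`map_localization_selmerGroup_eq_map_ker`** — for `N = m · d` with `m · Ш(E/K)[N] = 0` and `d E(K_𝔮) ⊆ N E(K_𝔮)`:
  `loc_𝔮(Sel_N(E/K)) = loc_𝔮(ker(H¹(K, E[N]) → H¹(K, E))) = loc_𝔮(κ_N E(K))` (`ker_torsionH1ToH1_le_selmerGroup` for `⊇`). Proof (Greenberg p. 122 «`S_{M^*}(F) = E(F)_p`»,
  made finite-level): for `s ∈ Sel_N`, `[p^e]_* s ∈ H¹(K, E[d])` dies in `H¹(K, E)` (`ι_* [p^e]_* s = p^e s` and `p^e` kills the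
  image of `s` in `Ш`), so `[p^e]_* s = κ_d(P)`, `P ∈ E(K)`; locally `loc s = κ_{N,𝔮}(X)`, `X ∈ E(K_𝔮)`, and `[p^e]_*` gives
  `κ_{d,𝔮}(X) = κ_{d,𝔮}(P)`, i.e. `X − P ∈ d E(K_𝔮) ⊆ N E(K_𝔮)`, whence `loc s = κ_{N,𝔮}(P) = loc κ_N(P)` (here `m = p^e`).
* §4 `exists_pow_nsmul_eq_zero_of_mem_sha` (`Sel_{p^∞}(E/K)` finite ⇒ a uniform `p^e` kills `Ш(E/K)[p^∞]`: lift to `Sel_{p^j}`,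
  push to `Sel_{p^∞}`), **`exists_map_localization_selmerGroup_eq_map_ker`**: ∃ `e a`, ∀ `k₀ ≥ a`, the equality of §3 at
  `N = p^e · p^{k₀}` for every finite `𝔮 ∤ p`.
HONEST FRAMING: any number field, any prime `p`, any `𝔮 ∤ p`, rational `p`-torsion ALLOWED; closes no item by itself; no summit
statement is proved; BSD is not proved by any of this.
References: [GreenbergLNM1716] §4 p. 104, Prop. 4.13 (pp. 121–123); [SilvermanAEC2009] VIII §2, X §4, VII.6.3; [MilneADT2006] I §6.
-/

noncomputable section

open scoped Classical NumberField

open Function NumberField IsDedekindDomain WeierstrassCurve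
open Literature.NumberTheory.EllipticCurves Literature.NumberTheory.GaloisRepresentations

universe u

namespace Summit.BirchSwinnertonDyer.BirchSwinnertonDyer.Theorems.InputsGreenbergCasselsTorsion

/-! ## §1 Local algebra at `𝔮 ∤ p` -/

section LocalAlgebra

variable {K : Type} [Field K] [NumberField K] (W : WeierstrassCurve K) [W.IsElliptic] (p : ℕ) [hp : Fact p.Prime]
  (𝔮 : HeightOneSpectrum (𝓞 K))

omit hp in
/-- Bézout in an abelian group: if `(p^a c') • X = p^{a+j} • u` with `c'` prime to `p`, then `p^a • X ∈ p^{a+j} • A`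
(`1 = A c' + B p^j` gives `p^a X = p^{a+j}(A u + B X)`). [folklore] -/
theorem exists_pow_nsmul_eq_of_coprime {A : Type*} [AddCommGroup A] {c' a j : ℕ} (hc' : Nat.Coprime c' p)
    {X u : A} (h : (p ^ a * c') • X = p ^ (a + j) • u) : ∃ Y : A, p ^ (a + j) • Y = p ^ a • X := by
  have hcop : Nat.Coprime c' (p ^ j) := hc'.pow_right j
  have hbez := Nat.gcd_eq_gcd_ab c' (p ^ j)
  rw [Nat.Coprime.gcd_eq_one hcop, Nat.cast_one] at hbez
  refine ⟨Nat.gcdA c' (p ^ j) • u + Nat.gcdB c' (p ^ j) • X, ?_⟩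
  have h' : ((p ^ a * c' : ℕ) : ℤ) • X = ((p ^ (a + j) : ℕ) : ℤ) • u := by
    rw [natCast_zsmul, natCast_zsmul]; exact h
  rw [← natCast_zsmul, ← natCast_zsmul, smul_add, smul_comm _ (Nat.gcdA c' (p ^ j)) u, ← h', smul_smul, smul_smul,
    ← add_smul]
  congr 1
  push_cast at hbez ⊢
  linear_combination (-((p : ℤ) ^ a)) * hbez

/-- **Local algebra at `𝔮 ∤ p`.** For `E = W` elliptic over a number field and a finite place `𝔮 ∤ p` there is `a : ℕ` with:
(i) for every `j` and every `X ∈ E(K_𝔮)`, `p^a X ∈ p^{a+j} E(K_𝔮)`; (ii) `p^a` kills every `p`-power-torsion point of `E(K_𝔮)`.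
Indeed `E(K_𝔮) ⊇ U` torsion-free of finite index `c = p^a c'` with `[U : p^j U] = #(𝓞_𝔮/p^j) = 1` (`p` is a unit of `𝓞_𝔮`), so
`U = p^j U`, `c X ∈ U`, and Bézout for `(c', p^j)`. [cite: SilvermanAEC2009, Prop. VII.6.3] [cite: MilneADT2006, I Lemma 3.3] -/
theorem exists_pow_divisible_point_adicCompletion (h𝔮 : ((p : ℕ) : 𝓞 K) ∉ 𝔮.asIdeal) :
    ∃ a : ℕ, (∀ (j : ℕ) (X : (W.baseChange (𝔮.adicCompletion K)).toAffine.Point),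
        ∃ Y : (W.baseChange (𝔮.adicCompletion K)).toAffine.Point, p ^ (a + j) • Y = p ^ a • X) ∧
      ∀ T : (W.baseChange (𝔮.adicCompletion K)).toAffine.Point, (∃ j : ℕ, p ^ j • T = 0) → p ^ a • T = 0 := by
  have hprime : p.Prime := hp.out
  obtain ⟨U, hfi, htf, hidx⟩ := W.exists_finiteIndex_torsionFree_adicCompletion 𝔮
  haveI := hfi
  -- `p^j` is a unit of `𝓞_𝔮`, so `[U : p^j U] = 1`, i.e. `U ⊆ p^j U`
  have hunit : ∀ j : ℕ, IsUnit ((p ^ j : ℕ) : 𝔮.adicCompletionIntegers K) := fun j ↦ by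
    have hnot : ((p ^ j : ℕ) : 𝓞 K) ∉ 𝔮.asIdeal := by
      rw [Nat.cast_pow]
      exact fun h ↦ h𝔮 (𝔮.isPrime.mem_of_pow_mem j h)
    have h := IsDedekindDomain.HeightOneSpectrum.isUnit_algebraMap_adicCompletionIntegers K 𝔮 hnot
    rwa [map_natCast] at h
  have hdivU : ∀ (j : ℕ) (u : (W.baseChange (𝔮.adicCompletion K)).toAffine.Point), u ∈ U →
      ∃ u' ∈ U, p ^ j • u' = u := by
    intro j u hu
    have hj : p ^ j ≠ 0 := pow_ne_zero j hprime.ne_zero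
    have h1 : (U.map (nsmulAddMonoidHom (p ^ j) : _ →+ _)).relIndex U = 1 := by
      rw [hidx (p ^ j) hj]
      haveI : Subsingleton (𝔮.adicCompletionIntegers K ⧸
          Ideal.span {((p ^ j : ℕ) : 𝔮.adicCompletionIntegers K)}) :=
        Ideal.Quotient.subsingleton_iff.mpr (Ideal.span_singleton_eq_top.mpr (hunit j))
      exact Nat.card_of_subsingleton (0 : 𝔮.adicCompletionIntegers K ⧸
          Ideal.span {((p ^ j : ℕ) : 𝔮.adicCompletionIntegers K)})
    have hle : U ≤ U.map (nsmulAddMonoidHom (p ^ j) : _ →+ _) := AddSubgroup.relIndex_eq_one.mp h1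
    obtain ⟨u', hu', rfl⟩ := hle hu
    exact ⟨u', hu', rfl⟩
  have hc0 : U.index ≠ 0 := hfi.index_ne_zero
  set a : ℕ := (U.index).factorization p with ha
  have hc : p ^ a * (U.index / p ^ a) = U.index := Nat.ordProj_mul_ordCompl_eq_self (U.index) p
  have hcop : Nat.Coprime (U.index / p ^ a) p := (Nat.coprime_ordCompl hprime hc0).symm
  refine ⟨a, fun j X ↦ ?_, fun T hT ↦ ?_⟩
  · have hcX : U.index • X ∈ U := U.nsmul_index_mem X
    obtain ⟨u, -, hu⟩ := hdivU (a + j) _ hcX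
    exact exists_pow_nsmul_eq_of_coprime p hcop (by rw [hc, hu])
  · obtain ⟨j, hj⟩ := hT
    have hcT : U.index • T = 0 := by
      refine htf (p ^ j) (pow_ne_zero j hprime.ne_zero) _ (U.nsmul_index_mem T) ?_
      rw [smul_comm, hj, smul_zero]
    -- Bézout for `(c', p^j)`: `p^a T = A c' p^a T + B p^j p^a T = 0`
    have hcop' : Nat.Coprime (U.index / p ^ a) (p ^ j) := hcop.pow_right j
    have hbez := Nat.gcd_eq_gcd_ab (U.index / p ^ a) (p ^ j)
    rw [Nat.Coprime.gcd_eq_one hcop', Nat.cast_one] at hbez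
    have h1 : ((U.index / p ^ a : ℕ) : ℤ) • ((p ^ a : ℕ) • T) = 0 := by
      rw [natCast_zsmul, smul_smul, mul_comm, hc, hcT]
    have h2 : ((p ^ j : ℕ) : ℤ) • ((p ^ a : ℕ) • T) = 0 := by
      rw [natCast_zsmul, smul_comm, hj, smul_zero]
    calc p ^ a • T = (1 : ℤ) • ((p ^ a : ℕ) • T) := by rw [one_smul]
      _ = ((U.index / p ^ a : ℕ) * Nat.gcdA (U.index / p ^ a) (p ^ j) +
            (p ^ j : ℕ) * Nat.gcdB (U.index / p ^ a) (p ^ j)) • ((p ^ a : ℕ) • T) := by rw [hbez]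
      _ = 0 := by
        rw [add_smul, mul_comm, mul_smul, h1, smul_zero, mul_comm, mul_smul, h2, smul_zero, add_zero]

end LocalAlgebra

/-! ## §2 Local Kummer maps on rational points: localisation of global Kummer classes; change of level -/

section LocalKummer

variable {K : Type} [Field K] [NumberField K] (W : WeierstrassCurve K) [W.IsElliptic] (𝔮 : HeightOneSpectrum (𝓞 K))

omit [NumberField K] [W.IsElliptic] in
/-- Coordinates: the geometric point of an `E`-rational point `R` of `W⁄E`, read in `E(K̄_E)` (`baseChangeGeomPointsEquiv`),
is `R` mapped along `E → K̄_E`. [folklore] -/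
theorem baseChangeGeomPointsEquiv_toGeomPoints (E : Type) [Field E] [Algebra K E]
    (R : (W.baseChange E).toAffine.Point) :
    W.baseChangeGeomPointsEquiv E (toGeomPoints (W.baseChange E) R) =
      (Affine.Point.map (W' := W) (IsScalarTower.toAlgHom K E (AlgebraicClosure E)) R : localPoints W E) := by
  rcases R with _ | ⟨x, y, h⟩
  · change W.baseChangeGeomPointsEquiv E (toGeomPoints (W.baseChange E) 0) =
      ((Affine.Point.map (W' := W) (IsScalarTower.toAlgHom K E (AlgebraicClosure E))
        (0 : (W.baseChange E).toAffine.Point) : (W.baseChange (AlgebraicClosure E)).toAffine.Point) : localPoints W E)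
    rw [map_zero, map_zero, map_zero]
    rfl
  · change W.baseChangeGeomPointsEquiv E
        (Affine.Point.map (W' := W.baseChange E) (Algebra.ofId E (AlgebraicClosure E)) (.some x y h)) = _
    rw [Affine.Point.map_some, Affine.Point.map_some]
    exact W.baseChangeGeomPointsEquiv_some E _

/-- **`loc_𝔮 κ_n(P) = κ_{n,𝔮}(P)`**: the localisation at a finite place `𝔮` of the global Kummer class of `P ∈ E(K)` is the
local Kummer class of `P ∈ E(K_𝔮)` (`localKummerMap`). Silverman X §4, commutativity of the left square of (**).
[cite: SilvermanAEC2009, X.§4 diagram (**)] -/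
theorem localization_kummerMapTorsion_eq_localKummerMap {n : ℤ} (hn : n ≠ 0)
    (hdiv : ∀ P : geomPoints W, ∃ Q : geomPoints W, n • Q = P) (P : W.toAffine.Point) :
    galoisCohomology.localization (W.torsionGaloisModule n) (Sum.inr 𝔮) 1 (kummerMapTorsion W n hdiv P) =
      W.localKummerMap (𝔮.adicCompletion K) hn (Affine.Point.baseChange (W' := W) K (𝔮.adicCompletion K) P) := by
  rw [kummerMapTorsion_apply, kummerMapTorsionFun]
  change galoisCohomology.res (W.torsionGaloisModule n) (𝔮.adicCompletion K) 1 _ = _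
  rw [W.res_kummerClassTorsion n hn _ _ (W.zsmul_pointsMap_mem_fixedPoints n _ (zsmul_zsmulRoot_mem W n hdiv P))]
  refine (W.localKummerMap_eq_localKummerClass (𝔮.adicCompletion K) hn _ _ _ ?_).symm
  rw [← map_zsmul, zsmul_zsmulRoot, baseChangeGeomPointsEquiv_toGeomPoints]
  change Affine.Point.map (closureEmb (K := K) (𝔮.adicCompletion K))
      (Affine.Point.baseChange (W' := W) K (AlgebraicClosure K) P) =
    Affine.Point.map _ (Affine.Point.baseChange (W' := W) K (𝔮.adicCompletion K) P)
  rw [Affine.Point.map_baseChange, Affine.Point.map_baseChange]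

/-- **Change of level on the local Kummer map: `[k]_* κ_{kd,𝔮}(X) = κ_{d,𝔮}(X)`** for `X ∈ E(K_𝔮)` (the root `R` of `X` at level
`kd` gives the root `kR` at level `d`; tree `map_torsionMulBy_localKummerClass`). [cite: MilneADT2006, Ch. I §6, proof of Prop. 6.9] -/
theorem map_torsionMulBy_localKummerMap (k d : ℤ) (hkd : k * d ≠ 0) (hd : d ≠ 0)
    (X : (W.baseChange (𝔮.adicCompletion K)).toAffine.Point) :
    galoisCohomology.map ((W.torsionMulBy k d).restrictField (𝔮.adicCompletion K)) 1
        (W.localKummerMap (𝔮.adicCompletion K) hkd X) = W.localKummerMap (𝔮.adicCompletion K) hd X := by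
  set R := W.localZSMulRoot (𝔮.adicCompletion K) hkd X with hR
  have hRX : (k * d) • R = W.baseChangeGeomPointsEquiv (𝔮.adicCompletion K)
      (toGeomPoints (W.baseChange (𝔮.adicCompletion K)) X) := W.zsmul_localZSMulRoot _ hkd X
  have hfix : d • (k • R) ∈ MulAction.fixedPoints (Field.absoluteGaloisGroup (𝔮.adicCompletion K))
      (localPoints W (𝔮.adicCompletion K)) := by
    rw [smul_smul, mul_comm]
    exact W.zsmul_mem_fixedPoints_of_eq (𝔮.adicCompletion K) hRX
  change galoisCohomology.map _ 1 (W.localKummerClass (k * d) hkd R _) = _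
  rw [W.map_torsionMulBy_localKummerClass k d hkd hd R _ hfix]
  exact (W.localKummerMap_eq_localKummerClass (𝔮.adicCompletion K) hd X (k • R) hfix
    (by rw [smul_smul, mul_comm, hRX])).symm

end LocalKummer

/-! ## §3 `loc_𝔮(Sel_N) = loc_𝔮(ker(H¹(K, E[N]) → H¹(K, E)))` at `𝔮 ∤ p`, deep level -/

section LocImage

variable {K : Type} [Field K] [NumberField K] (W : WeierstrassCurve K) [W.IsElliptic] (p : ℕ) [hp : Fact p.Prime]
  (𝔮 : HeightOneSpectrum (𝓞 K))

omit [W.IsElliptic] in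
/-- `ker(H¹(K, E[n]) → H¹(K, E)) ⊆ Sel_n(E/K)`: a class dying in `H¹(K, E)` is the Kummer class of a rational point, which
satisfies every local condition. Silverman X §4 (Thm. X.4.2 (a)). [cite: SilvermanAEC2009, Thm X.4.2(a)] -/
theorem ker_torsionH1ToH1_le_selmerGroup {n : ℤ} (hn : n ≠ 0) : (torsionH1ToH1 W n).ker ≤ W.selmerGroup n := by
  intro x hx
  obtain ⟨P, rfl⟩ := W.mem_range_kummerMapTorsion_of_torsionH1ToH1_eq_zero n (W.zsmul_geomPoints_surjective_of_charZero hn)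
    x ((AddMonoidHom.mem_ker).mp hx)
  exact (W.mem_selmerGroup_iff n _).mpr ⟨fun v ↦ W.kummerMapTorsion_mem_selmerLocalKer n _ _ P,
    fun w ↦ W.kummerMapTorsion_mem_selmerLocalKer n _ _ P⟩

/-- **`loc_𝔮(Sel_N(E/K)) = loc_𝔮(ker(H¹(K, E[N]) → H¹(K, E)))` at a finite place `𝔮`, level `N = m · d`.** Assume: `m`
kills every element of `Ш(E/K)` killed by `N`; and `d E(K_𝔮) ⊆ N E(K_𝔮)` (for `N = p^e · p^{k₀}`, `𝔮 ∤ p`, `k₀` large and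
`Sel_{p^∞}(E/K)` finite both hold, §1/§4). Then the two subgroups of `H¹(K_𝔮, E[N])` coincide. This is the finite-level content of
Greenberg's «`S_{M^*}(F) = E(F)_p`» in the proof of Prop. 4.13: the Kummer image at `𝔮` of the Selmer group is exactly the Kummer
image of the rational points. [cite: GreenbergLNM1716, §4 Appendix Prop. 4.13 (pp. 121–122)]
[cite: SilvermanAEC2009, VIII §2 and X §4] [cite: MilneADT2006, Ch. I §6, proof of Prop. 6.9] -/
theorem map_localization_selmerGroup_eq_map_ker (m : ℕ) (d : ℤ) (hm0 : m ≠ 0) (hd0 : d ≠ 0)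
    (hSha : ∀ x ∈ W.sha, ((m : ℤ) * d) • x = 0 → m • x = 0)
    (hloc : ∀ X : (W.baseChange (𝔮.adicCompletion K)).toAffine.Point,
      ∃ Y : (W.baseChange (𝔮.adicCompletion K)).toAffine.Point, ((m : ℤ) * d) • Y = d • X) :
    (W.selmerGroup ((m : ℤ) * d)).map
        (galoisCohomology.localization (W.torsionGaloisModule ((m : ℤ) * d)) (Sum.inr 𝔮) 1) =
      ((torsionH1ToH1 W ((m : ℤ) * d)).ker).map
        (galoisCohomology.localization (W.torsionGaloisModule ((m : ℤ) * d)) (Sum.inr 𝔮) 1) := by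
  have hm0' : (m : ℤ) ≠ 0 := by exact_mod_cast hm0
  have hN0 : (m : ℤ) * d ≠ 0 := mul_ne_zero hm0' hd0
  have hdN : d ∣ (m : ℤ) * d := Dvd.intro_left _ rfl
  haveI : CharZero (𝔮.adicCompletion K) := charZero_of_injective_algebraMap (algebraMap K (𝔮.adicCompletion K)).injective
  refine le_antisymm ?_ (AddSubgroup.map_mono (ker_torsionH1ToH1_le_selmerGroup W hN0))
  rintro _ ⟨s, hs, rfl⟩
  -- (1) `m` kills the image of `s` in `Ш`
  have hsha : torsionH1ToH1 W ((m : ℤ) * d) s ∈ W.sha ⊓ AddSubgroup.torsionBy W.galH1 ((m : ℤ) * d) := by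
    rw [← W.map_torsionH1ToH1_selmerGroup_kummerSelmerStructure ((m : ℤ) * d) hN0,
      ← selmerGroup_eq_selmerGroup_kummerSelmerStructure]
    exact AddSubgroup.mem_map_of_mem _ hs
  have hkill : m • torsionH1ToH1 W ((m : ℤ) * d) s = 0 := hSha _ hsha.1 hsha.2
  -- (2) `[m]_* s ∈ H¹(K, E[d])` dies in `H¹(K, E)` (`ι_* [m]_* s = m • s`)
  have hπ0 : torsionH1ToH1 W d (galoisCohomology.map (W.torsionMulBy (m : ℤ) d) 1 s) = 0 := by
    have h := SignedEC.CasselsPT.map_torsionInclusion_map_torsionMulBy W m d hdN s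
    have h' : torsionH1ToH1 W ((m : ℤ) * d)
        (galoisCohomology.map (W.torsionInclusion hdN) 1 (galoisCohomology.map (W.torsionMulBy (m : ℤ) d) 1 s)) =
        torsionH1ToH1 W d (galoisCohomology.map (W.torsionMulBy (m : ℤ) d) 1 s) := by
      rw [map_torsionInclusion_one_apply, torsionH1ToH1_torsionH1OfDvd]
    rw [← h', h]
    exact (map_nsmul (torsionH1ToH1 W ((m : ℤ) * d)) m s).trans hkill
  -- (3) so `[m]_* s = κ_d(P)` with `P ∈ E(K)`
  have hdivd := W.zsmul_geomPoints_surjective_of_charZero hd0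
  have hdivN := W.zsmul_geomPoints_surjective_of_charZero hN0
  obtain ⟨P, hP⟩ := W.mem_range_kummerMapTorsion_of_torsionH1ToH1_eq_zero d hdivd _ hπ0
  -- (4) locally `loc s = κ_{N,𝔮}(X)` with `X ∈ E(K_𝔮)`
  have hsL : galoisCohomology.localization (W.torsionGaloisModule ((m : ℤ) * d)) (Sum.inr 𝔮) 1 s ∈
      (W.localKummerMap (𝔮.adicCompletion K) hN0).range := by
    rw [W.range_localKummerMap (𝔮.adicCompletion K) hN0]
    have h := (W.mem_selmerGroup_iff_forall_localization_mem ((m : ℤ) * d) s).mp hs (Sum.inr 𝔮)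
    rwa [kummerSelmerStructure_apply] at h
  obtain ⟨X, hX⟩ := hsL
  -- (5) apply `[m]_*`: `κ_{d,𝔮}(X) = κ_{d,𝔮}(P)`
  have h5 : W.localKummerMap (𝔮.adicCompletion K) hd0 X =
      W.localKummerMap (𝔮.adicCompletion K) hd0 (Affine.Point.baseChange (W' := W) K (𝔮.adicCompletion K) P) := by
    have h1 := map_torsionMulBy_localKummerMap W 𝔮 (m : ℤ) d hN0 hd0 X
    have h2 : galoisCohomology.map ((W.torsionMulBy (m : ℤ) d).restrictField (𝔮.adicCompletion K)) 1
          (galoisCohomology.localization (W.torsionGaloisModule ((m : ℤ) * d)) (Sum.inr 𝔮) 1 s) =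
        galoisCohomology.localization (W.torsionGaloisModule d) (Sum.inr 𝔮) 1
          (galoisCohomology.map (W.torsionMulBy (m : ℤ) d) 1 s) :=
      (Summit.BirchSwinnertonDyer.Rank1Residual.X11b.Levels.localization_map_one (W.torsionMulBy (m : ℤ) d)
        (Sum.inr 𝔮) s).symm
    rw [← h1, hX, h2, ← hP]
    exact localization_kummerMapTorsion_eq_localKummerMap W 𝔮 hd0 hdivd P
  -- (6) hence `X − P ∈ d E(K_𝔮) ⊆ N E(K_𝔮)`: `X = P + N • Y`
  have h6 : X - Affine.Point.baseChange (W' := W) K (𝔮.adicCompletion K) P ∈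
      (W.localKummerMap (𝔮.adicCompletion K) hd0).ker := by
    rw [AddMonoidHom.mem_ker, map_sub, h5, sub_self]
  rw [W.ker_localKummerMap (𝔮.adicCompletion K) hd0] at h6
  obtain ⟨X₁, hX₁⟩ := h6
  obtain ⟨Y, hY⟩ := hloc X₁
  have hXP : X = Affine.Point.baseChange (W' := W) K (𝔮.adicCompletion K) P + ((m : ℤ) * d) • Y := by
    have h1 : d • X₁ = X - Affine.Point.baseChange (W' := W) K (𝔮.adicCompletion K) P := hX₁
    rw [hY, h1]
    abel
  -- (7) `loc s = κ_{N,𝔮}(X) = κ_{N,𝔮}(P) = loc κ_N(P)`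
  have hNY : W.localKummerMap (𝔮.adicCompletion K) hN0 (((m : ℤ) * d) • Y) = 0 := by
    have : ((m : ℤ) * d) • Y ∈ (W.localKummerMap (𝔮.adicCompletion K) hN0).ker := by
      rw [W.ker_localKummerMap (𝔮.adicCompletion K) hN0]; exact ⟨Y, rfl⟩
    exact (AddMonoidHom.mem_ker).mp this
  refine ⟨kummerMapTorsion W ((m : ℤ) * d) hdivN P,
    (AddMonoidHom.mem_ker).mpr (W.torsionH1ToH1_kummerMapTorsion ((m : ℤ) * d) hdivN P), ?_⟩
  rw [localization_kummerMapTorsion_eq_localKummerMap W 𝔮 hN0 hdivN P, ← hX, hXP, map_add, hNY, add_zero]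

end LocImage

/-! ## §4 The exponent from `Sel_{p^∞}(E/K)` finite, and the packaged statement -/

section Packaged

variable {K : Type} [Field K] [NumberField K] (W : WeierstrassCurve K) [W.IsElliptic] (p : ℕ) [hp : Fact p.Prime]

omit [W.IsElliptic] in
/-- **`Sel_{p^∞}(E/K)` finite ⇒ a uniform power of `p` kills the `p`-power torsion of `Ш(E/K)`**: `Sel_{p^∞}(E/K) ↠ Ш(E/K)(p)`
(`map_primaryH1ToH1_selmerGroupPInfty_eq_sha_inf_range` ⊇ and the lift `exists_mem_selmerGroup_kummerSelmerStructure_of_mem_sha`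
at level `p^j`, `torsionPowToPrimaryH1`). [cite: GreenbergLNM1716, §2 pp. 62–63] -/
theorem exists_pow_nsmul_eq_zero_of_mem_sha [Finite (W.selmerGroupPInfty p)] :
    ∃ e : ℕ, ∀ x ∈ W.sha, (∃ j : ℕ, p ^ j • x = 0) → p ^ e • x = 0 := by
  have hprime : p.Prime := hp.out
  obtain ⟨e, he⟩ := SignedEC.CasselsPT.exists_forall_pow_nsmul_eq_zero_of_finite W p (W.selmerGroupPInfty p)
  refine ⟨e, fun x hx ⟨j, hj⟩ ↦ ?_⟩
  -- lift `x ∈ Ш[p^j]` to `Sel_{p^j}`, then push to `Sel_{p^∞}`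
  have hN0 : ((p ^ j : ℕ) : ℤ) ≠ 0 := by exact_mod_cast pow_ne_zero j hprime.ne_zero
  obtain ⟨b, hb, hbx⟩ := W.exists_mem_selmerGroup_kummerSelmerStructure_of_mem_sha ((p ^ j : ℕ) : ℤ) hN0 hx
    (by rw [natCast_zsmul]; exact hj)
  rw [← selmerGroup_eq_selmerGroup_kummerSelmerStructure] at hb
  have hy : W.torsionPowToPrimaryH1 p j b ∈ W.selmerGroupPInfty p := W.torsionPowToPrimaryH1_mem_selmerGroupPInfty p j hb
  rw [← hbx, ← W.primaryH1ToH1_torsionPowToPrimaryH1 p j b, ← map_nsmul, he _ hy, map_zero]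

/-- **PACKAGED: at every finite place `𝔮 ∤ p`, `loc_𝔮(Sel_N(E/K)) = loc_𝔮(ker(H¹(K, E[N]) → H¹(K, E)))` at all deep levels**
(`Sel_{p^∞}(E/K)` finite, rational `p`-torsion allowed): there are `e a : ℕ` such that the equality of §3 holds at
`N = p^e · p^{k₀}` for every `k₀ ≥ a`. [cite: GreenbergLNM1716, §4 Appendix Prop. 4.13 (pp. 121–122)] -/
theorem exists_map_localization_selmerGroup_eq_map_ker [Finite (W.selmerGroupPInfty p)] (𝔮 : HeightOneSpectrum (𝓞 K))
    (h𝔮 : ((p : ℕ) : 𝓞 K) ∉ 𝔮.asIdeal) :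
    ∃ e a : ℕ, ∀ k₀ : ℕ, a ≤ k₀ →
      (W.selmerGroup (((p ^ e : ℕ) : ℤ) * ((p ^ k₀ : ℕ) : ℤ))).map
          (galoisCohomology.localization (W.torsionGaloisModule (((p ^ e : ℕ) : ℤ) * ((p ^ k₀ : ℕ) : ℤ))) (Sum.inr 𝔮) 1) =
        ((torsionH1ToH1 W (((p ^ e : ℕ) : ℤ) * ((p ^ k₀ : ℕ) : ℤ))).ker).map
          (galoisCohomology.localization (W.torsionGaloisModule (((p ^ e : ℕ) : ℤ) * ((p ^ k₀ : ℕ) : ℤ))) (Sum.inr 𝔮) 1) := by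
  have hprime : p.Prime := hp.out
  obtain ⟨e, he⟩ := exists_pow_nsmul_eq_zero_of_mem_sha W p
  obtain ⟨a, ha, -⟩ := exists_pow_divisible_point_adicCompletion W p 𝔮 h𝔮
  refine ⟨e, a, fun k₀ hk₀ ↦ map_localization_selmerGroup_eq_map_ker W 𝔮 (p ^ e) ((p ^ k₀ : ℕ) : ℤ)
    (pow_ne_zero e hprime.ne_zero) (by exact_mod_cast pow_ne_zero k₀ hprime.ne_zero)
    (fun x hx hNx ↦ he x hx ⟨e + k₀, ?_⟩) fun X ↦ ?_⟩
  · rw [← Nat.cast_mul, ← pow_add, natCast_zsmul] at hNx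
    exact hNx
  · obtain ⟨Y, hY⟩ := ha (k₀ - a + e) (p ^ (k₀ - a) • X)
    refine ⟨Y, ?_⟩
    rw [← Nat.cast_mul, ← pow_add, natCast_zsmul, natCast_zsmul, show e + k₀ = a + (k₀ - a + e) by omega, hY,
      ← mul_smul, ← pow_add, show a + (k₀ - a) = k₀ by omega]

end Packaged

end Summit.BirchSwinnertonDyer.BirchSwinnertonDyer.Theorems.InputsGreenbergCasselsTorsion

end
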